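import Summits.CriticalPhenomena.PercolationContinuityZ3.Theorems.PercNearOneGluingAdditiveGluingPeelGlueTransfer
import HarnessLib

/-! # Crux `PercNearOneGluing.AdditiveGluing` (stmt-CriticalPhenomena-4576), line `peel`, stub `stub_bystanderPockets_c5` —
# the bystander σ-identity P (the dead-pocket sum of a grown block through the open star of the new vertex)

Support file (`--supports stmt-CriticalPhenomena-4576`); no definitions, no named facts.

`μ_u = prodBernoulli u` (bond percolation on `Fin n`), relays `A ∋ b`, a block `T`, a new vertex `x ∉ A ∪ T`; for a finite set
`S` of vertices write `K_S(ω) = ⋃_{v ∈ S} C(v)` (the vertices joined to `S`), so that `{K_S = W}` is the event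
`{ω | ∀ z, z ∈ W ↔ ω ∈ ⋃ v ∈ S, {v ↔ z}}`.  The identity proved here is the law of total probability over the OPEN STAR of
`x`: on the layer `L_B = {the open neighbours of x are exactly B}` one has `K_{T ∪ {x}}(ω) = K_{T ∪ B}(Ψ_B ω) ∪ {x}` with
`Ψ_B ω = {e ∈ ω | x ∉ e} ∪ {non-loop pairs inside B}` (`x` deleted, `B` glued; `stub_sigmaGeometry`), the law of `Ψ_B` on
`L_B` is `μ_{q_B}` with `q_B = ` (`u` with the star of `x` killed and `B` glued) (`stub_sigmaLaw`), the pockets correspond by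
`W ↦ W ∖ {x}`, and on a pocket `W' ⊇ T ∪ B` of positive mass the worst-selection factors agree,
`μ_u(a ↔ b in (W' ∪ {x})ᶜ) = μ_{q_B}(a ↔ b in W'ᶜ)` (the event only sees pairs avoiding `W' ∪ {x}`, where `u = q_B`, and under
`q_B` the isolated vertex `x` may be added to the forbidden set for free).  Hence
`Σ_{W ∩ A = ∅} μ_u(K_{T∪x} = W) · min_A μ_u(· ↔ b in Wᶜ)`
`  = Σ_B μ_u(L_B) · Σ_{W' ∩ A = ∅} μ_{q_B}(K_{T∪B} = W') · min_A μ_{q_B}(· ↔ b in W'ᶜ)`.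
[cite: KozmaNitzan2024, §3.2 pp. 13–14 (the `σ_B`-decomposition)]
-/

namespace Summit.CriticalPhenomena.PercolationContinuityZ3.Theorems

open MeasureTheory Set
open Literature.Probability.LatticeModels (prodBernoulli)
open Literature.Probability.Percolation (BondConfig openConn openConnIn openGraph openCluster)
open scoped BigOperators Classical

noncomputable section

section BystanderPockets

open Literature.Probability.LatticeModels Literature.Probability.Percolation

variable {n : ℕ}

/-- **Geometry on a layer of the star of `x`.**  If the open neighbours of `x` (other than `x`) are exactly `B`, then for
`x ∈ W`, `x ∉ T`: the vertices joined to `T ∪ {x}` in `ω` are exactly `W` iff the vertices joined to `T ∪ B` in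
`Ψ_B ω = {e ∈ ω | x ∉ e} ∪ {non-loop pairs inside B}` are exactly `W ∖ {x}` (`stub_sigmaGeometry` with the block `{x}`;
`x` is isolated in `Ψ_B ω`). [cite: KozmaNitzan2024, §3.2 p. 14] -/
theorem bystP_geometry (T B W : Finset (Fin n)) (x : Fin n) (hxT : x ∉ T) (hxW : x ∈ W)
    (ω : BondConfig (Fin n))
    (hL : ∀ y : Fin n, y ∈ B ↔ (y ∉ ({x} : Finset (Fin n)) ∧ ∃ o ∈ ({x} : Finset (Fin n)), s(o, y) ∈ ω)) :
    (∀ z : Fin n, (z ∈ W ↔ ω ∈ ⋃ v ∈ insert x T, openConn v z)) ↔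
      ∀ z : Fin n, (z ∈ W.erase x ↔
        ({e | e ∈ ω ∧ ∀ y ∈ e, y ∉ ({x} : Finset (Fin n))} ∪ {e | (∀ y ∈ e, y ∈ B) ∧ ¬ e.IsDiag} :
            BondConfig (Fin n)) ∈ ⋃ v ∈ T ∪ B, openConn v z) := by
  have hxB : x ∉ B := fun h => ((hL x).1 h).1 (Finset.mem_singleton_self x)
  have hclique : ∀ o ∈ ({x} : Finset (Fin n)), ∀ o' ∈ ({x} : Finset (Fin n)), o ≠ o' → s(o, o') ∈ ω :=
    fun o ho o' ho' hne =>
      absurd ((Finset.mem_singleton.1 ho).trans (Finset.mem_singleton.1 ho').symm) hne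
  obtain ⟨h1, h2⟩ := stub_sigmaGeometry n {x} B ω hL hclique
  -- no pair at `x` is open in `Ψ_B ω`
  have hstar : ∀ y : Fin n, s(x, y) ∉ ({e | e ∈ ω ∧ ∀ y ∈ e, y ∉ ({x} : Finset (Fin n))} ∪
      {e | (∀ y ∈ e, y ∈ B) ∧ ¬ e.IsDiag} : BondConfig (Fin n)) := by
    rintro y (⟨-, h⟩ | ⟨h, -⟩)
    · exact h x (Sym2.mem_mk_left x y) (Finset.mem_singleton_self x)
    · exact hxB (h x (Sym2.mem_mk_left x y))
  -- hence `x` is joined to no other vertex in `Ψ_B ω`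
  have hiso : ∀ v : Fin n, v ≠ x → ({e | e ∈ ω ∧ ∀ y ∈ e, y ∉ ({x} : Finset (Fin n))} ∪
      {e | (∀ y ∈ e, y ∈ B) ∧ ¬ e.IsDiag} : BondConfig (Fin n)) ∉ openConn v x := by
    intro v hv h
    obtain ⟨z, -, hz, -⟩ := goodBase_exists_open_pair (SimpleGraph.Reachable.symm h) hv
    exact hstar z hz
  -- the reach of a vertex `z ≠ x`
  have hkey : ∀ z : Fin n, z ≠ x →
      ((ω ∈ ⋃ v ∈ insert x T, openConn v z) ↔
        ({e | e ∈ ω ∧ ∀ y ∈ e, y ∉ ({x} : Finset (Fin n))} ∪ {e | (∀ y ∈ e, y ∈ B) ∧ ¬ e.IsDiag} :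
            BondConfig (Fin n)) ∈ ⋃ v ∈ T ∪ B, openConn v z) := by
    intro z hz
    have hx' := h1 {z} (Finset.disjoint_singleton_left.2 fun h => hz (Finset.mem_singleton.1 h).symm)
    simp only [Finset.set_biUnion_singleton] at hx'
    simp only [Set.mem_iUnion, exists_prop, Finset.mem_insert, Finset.mem_union] at hx' ⊢
    constructor
    · rintro ⟨v, rfl | hv, hvz⟩
      · obtain ⟨s, hs, hsz⟩ := hx'.1 hvz
        exact ⟨s, Or.inr hs, hsz⟩
      · exact ⟨v, Or.inl hv, (h2 v z (fun h => hxT ((Finset.mem_singleton.1 h) ▸ hv))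
          (fun h => hz (Finset.mem_singleton.1 h))).1 hvz⟩
    · rintro ⟨v, hv | hv, hvz⟩
      · exact ⟨v, Or.inr hv, (h2 v z (fun h => hxT ((Finset.mem_singleton.1 h) ▸ hv))
          (fun h => hz (Finset.mem_singleton.1 h))).2 hvz⟩
      · exact ⟨x, Or.inl rfl, hx'.2 ⟨v, hv, hvz⟩⟩
  constructor
  · intro h z
    by_cases hz : z = x
    · rw [hz]
      refine iff_of_false (Finset.notMem_erase x W) ?_
      simp only [Set.mem_iUnion, exists_prop, not_exists, not_and]
      intro v hv
      refine hiso v ?_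
      rintro rfl
      exact (Finset.mem_union.1 hv).elim hxT hxB
    · rw [Finset.mem_erase, ← hkey z hz, ← h z]
      exact ⟨fun h => h.2, fun h => ⟨hz, h⟩⟩
  · intro h z
    by_cases hz : z = x
    · rw [hz]
      refine iff_of_true hxW ?_
      exact Set.mem_iUnion₂.2 ⟨x, Finset.mem_insert_self x T, SimpleGraph.Reachable.refl _⟩
    · rw [hkey z hz, ← h z, Finset.mem_erase]
      exact ⟨fun h => ⟨hz, h⟩, fun h => h.2⟩

/-- **The bystander σ-identity P, abstract form.**  `p` is the ambient weighting, `L B` the layer events of the star of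
`x` (partitioning the space, `hpart`), `Ψ B` the delete-`x`/glue-`B` map with law `q B` on `L B` (`hlaw`) and the cluster
geometry `hgeo` (`bystP_geometry`); `q B` kills the star of `x` (`hqx`) and agrees with `p` on the pairs avoiding any
`W ∋ x` containing `B` (`hqW`).  Then the dead-pocket sum with worst selection of the block `T ∪ {x}` under `p` is the
`L`-average of the dead-pocket sums of the blocks `T ∪ B` under `q B`: swap the sums, re-index the pockets by
`W' = W ∖ {x}` (pockets `W ∌ x` on the left are empty, pockets `W' ∋ x` on the right are null, `goodStep24_block_null`),
factor the layer (`hlaw` + `hgeo`) and identify the factors (`prodBernoulli_real_eq_of_determinedBy` on the pairs avoiding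
`W`, `goodStep24_real_openConnIn_insert` for the isolated vertex `x`). [cite: KozmaNitzan2024, §3.2 pp. 13–14] -/
theorem bystP_engine (p : Sym2 (Fin n) → unitInterval)
    (q : Finset (Fin n) → Sym2 (Fin n) → unitInterval)
    (L : Finset (Fin n) → Set (BondConfig (Fin n)))
    (Ψ : Finset (Fin n) → BondConfig (Fin n) → BondConfig (Fin n))
    (A T : Finset (Fin n)) (x b : Fin n) (hb : b ∈ A) (hxT : x ∉ T) (hxA : x ∉ A)
    (hpart : ∀ F : Set (BondConfig (Fin n)),
      (prodBernoulli p).real F = ∑ B : Finset (Fin n), (prodBernoulli p).real (L B ∩ F))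
    (hlaw : ∀ (B : Finset (Fin n)) (E : Set (BondConfig (Fin n))),
      (prodBernoulli p).real (L B ∩ {ω | Ψ B ω ∈ E}) =
        (prodBernoulli p).real (L B) * (prodBernoulli (q B)).real E)
    (hgeo : ∀ (B W : Finset (Fin n)) (ω : BondConfig (Fin n)), ω ∈ L B → x ∈ W →
      ((∀ z : Fin n, (z ∈ W ↔ ω ∈ ⋃ v ∈ insert x T, openConn v z)) ↔
        ∀ z : Fin n, (z ∈ W.erase x ↔ Ψ B ω ∈ ⋃ v ∈ T ∪ B, openConn v z)))
    (hLx : ∀ B : Finset (Fin n), (prodBernoulli p).real (L B) ≠ 0 → x ∉ B)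
    (hqx : ∀ B : Finset (Fin n), x ∉ B → ∀ z : Fin n, q B s(x, z) = 0)
    (hqW : ∀ B W : Finset (Fin n), x ∈ W → B ⊆ W →
      ∀ e ∈ ((W : Set (Fin n))ᶜ).sym2, p e = q B e) :
    (∑ W ∈ (Finset.univ : Finset (Finset (Fin n))).filter (fun W => Disjoint W A),
        (prodBernoulli p).real
            {ω : BondConfig (Fin n) | ∀ z : Fin n, (z ∈ W ↔ ω ∈ ⋃ v ∈ insert x T, openConn v z)}
          * A.inf' ⟨b, hb⟩ (fun a => (prodBernoulli p).real (openConnIn ((W : Set (Fin n))ᶜ) a b)))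
      = ∑ B : Finset (Fin n), (prodBernoulli p).real (L B) *
          (∑ W ∈ (Finset.univ : Finset (Finset (Fin n))).filter (fun W => Disjoint W A),
            (prodBernoulli (q B)).real
                {ω : BondConfig (Fin n) | ∀ z : Fin n, (z ∈ W ↔ ω ∈ ⋃ v ∈ T ∪ B, openConn v z)}
              * A.inf' ⟨b, hb⟩ (fun a => (prodBernoulli (q B)).real (openConnIn ((W : Set (Fin n))ᶜ) a b))) := by
  symm
  -- the identity layer by layer
  have hB : ∀ B : Finset (Fin n), (prodBernoulli p).real (L B) *
      (∑ W ∈ (Finset.univ : Finset (Finset (Fin n))).filter (fun W => Disjoint W A),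
        (prodBernoulli (q B)).real
            {ω : BondConfig (Fin n) | ∀ z : Fin n, (z ∈ W ↔ ω ∈ ⋃ v ∈ T ∪ B, openConn v z)}
          * A.inf' ⟨b, hb⟩ (fun a => (prodBernoulli (q B)).real (openConnIn ((W : Set (Fin n))ᶜ) a b))) =
      ∑ W ∈ (Finset.univ : Finset (Finset (Fin n))).filter (fun W => Disjoint W A),
        (prodBernoulli p).real (L B ∩
            {ω : BondConfig (Fin n) | ∀ z : Fin n, (z ∈ W ↔ ω ∈ ⋃ v ∈ insert x T, openConn v z)})
          * A.inf' ⟨b, hb⟩ (fun a => (prodBernoulli p).real (openConnIn ((W : Set (Fin n))ᶜ) a b)) := by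
    intro B
    rw [Finset.mul_sum]
    refine Eq.trans (Finset.sum_filter_of_ne (p := fun W => x ∉ W) fun W _ hne => ?_).symm
      (Eq.trans ?_ (Finset.sum_filter_of_ne (p := fun W => x ∈ W) fun W _ hne => ?_))
    · -- pockets `W ∋ x` are null under `q B` (or the layer is null)
      intro hxW
      apply hne
      rcases eq_or_ne ((prodBernoulli p).real (L B)) 0 with h0 | h0
      · rw [h0, zero_mul]
      · rw [goodStep24_block_null (q B) x (T ∪ B) W (hqx B (hLx B h0))
          (fun h => (Finset.mem_union.1 h).elim hxT (hLx B h0)) hxW, zero_mul, mul_zero]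
    · -- re-index `W = insert x W'`
      refine Finset.sum_nbij' (fun W => insert x W) (fun W => W.erase x) ?_ ?_ ?_ ?_ ?_
      · intro W hW
        simp only [Finset.mem_filter, Finset.mem_univ, true_and] at hW ⊢
        exact ⟨Finset.disjoint_insert_left.2 ⟨hxA, hW.1⟩, Finset.mem_insert_self x W⟩
      · intro W hW
        simp only [Finset.mem_filter, Finset.mem_univ, true_and] at hW ⊢
        exact ⟨Finset.disjoint_of_subset_left (Finset.erase_subset x W) hW.1, Finset.notMem_erase x W⟩
      · intro W hW
        simp only [Finset.mem_filter, Finset.mem_univ, true_and] at hW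
        exact Finset.erase_insert hW.2
      · intro W hW
        simp only [Finset.mem_filter, Finset.mem_univ, true_and] at hW
        exact Finset.insert_erase hW.2
      · intro W hW
        simp only [Finset.mem_filter, Finset.mem_univ, true_and] at hW
        obtain ⟨-, hxW⟩ := hW
        -- the layer factorises (law + geometry)
        have hfac : (prodBernoulli p).real (L B ∩
            {ω : BondConfig (Fin n) | ∀ z : Fin n, (z ∈ insert x W ↔ ω ∈ ⋃ v ∈ insert x T, openConn v z)}) =
            (prodBernoulli p).real (L B) * (prodBernoulli (q B)).real
              {ω : BondConfig (Fin n) | ∀ z : Fin n, (z ∈ W ↔ ω ∈ ⋃ v ∈ T ∪ B, openConn v z)} := by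
          rw [← hlaw B]
          congr 1
          ext ω
          simp only [Set.mem_inter_iff, Set.mem_setOf_eq]
          refine and_congr_right fun hLω => ?_
          have h := hgeo B (insert x W) ω hLω (Finset.mem_insert_self x W)
          rw [Finset.erase_insert hxW] at h
          exact h
        rw [hfac, mul_assoc]
        rcases eq_or_ne ((prodBernoulli p).real (L B)) 0 with hL0 | hL0
        · rw [hL0, zero_mul, zero_mul]
        rcases eq_or_ne ((prodBernoulli (q B)).real
            {ω : BondConfig (Fin n) | ∀ z : Fin n, (z ∈ W ↔ ω ∈ ⋃ v ∈ T ∪ B, openConn v z)}) 0 with hK0 | hK0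
        · rw [hK0, zero_mul, zero_mul]
        have hxB : x ∉ B := hLx B hL0
        have hTBW : T ∪ B ⊆ W := by
          by_contra hc
          exact hK0 (by rw [peelGlue_pocket_eq_empty (T ∪ B) (T ∪ B) W (Finset.Subset.refl _) hc, measureReal_empty])
        have hBW : B ⊆ insert x W := fun y hy => Finset.mem_insert_of_mem (hTBW (Finset.mem_union_right T hy))
        -- the worst-selection factors agree on the relays
        have hinf : A.inf' ⟨b, hb⟩ (fun a => (prodBernoulli (q B)).real (openConnIn ((W : Set (Fin n))ᶜ) a b)) =
            A.inf' ⟨b, hb⟩ (fun a => (prodBernoulli p).real (openConnIn ((↑(insert x W) : Set (Fin n))ᶜ) a b)) := by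
          refine Finset.inf'_congr _ rfl fun a ha => ?_
          have hax : a ≠ x := fun h => hxA (h ▸ ha)
          rw [goodStep24_real_openConnIn_insert (q B) x a b W (hqx B hxB) hax]
          exact (prodBernoulli_real_eq_of_determinedBy p (q B)
            (hqW B (insert x W) (Finset.mem_insert_self x W) hBW)
            (DCT16.determinedBy_openConnIn _ a b subset_rfl) MeasurableSet.of_discrete).symm
        rw [hinf]
    · -- pockets `W ∌ x` of the grown block are empty
      by_contra hxW
      apply hne
      rw [peelGlue_pocket_eq_empty {x} (insert x T) W (Finset.singleton_subset_iff.2 (Finset.mem_insert_self x T))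
        (fun h => hxW (Finset.singleton_subset_iff.1 h)), Set.inter_empty, measureReal_empty, zero_mul]
  rw [Finset.sum_congr rfl fun B _ => hB B, Finset.sum_comm]
  refine Finset.sum_congr rfl fun W _ => ?_
  rw [← Finset.sum_mul, ← hpart]

end BystanderPockets

/-- Registered stub `stub_bystanderPockets_c5` of crux stmt-CriticalPhenomena-4576 (line `peel`, wave 2 of lead c5):
**the bystander σ-identity P** — the dead-pocket sum with worst selection of the grown block `T ∪ {x}` under `μ_u` is the
average, over the layer `B` of the open star of `x`, of the dead-pocket sums of the blocks `T ∪ B` under the weighting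
`q_B` (`x` deleted, `B` glued):
`Σ_{W ∩ A = ∅} μ_u(K_{T∪x} = W) · min_A μ_u(· ↔ b in Wᶜ)`
`  = Σ_B μ_u(layer = B) · Σ_{W ∩ A = ∅} μ_{q_B}(K_{T∪B} = W) · min_A μ_{q_B}(· ↔ b in Wᶜ)`.
Instance of `bystP_engine` with `stub_sigmaLaw` / `stub_sigmaGeometry` at the block `{x}` (`glue u {x} = u`).
[cite: KozmaNitzan2024, §3.2 pp. 13–14 (the `σ_B`-decomposition)] -/
theorem stub_bystanderPockets_c5 :
    ∀ (n : ℕ) (u : Sym2 (Fin n) → unitInterval) (A T : Finset (Fin n)) (x b : Fin n) (hb : b ∈ A),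
      x ∉ T → x ∉ A →
      (∑ W ∈ (Finset.univ : Finset (Finset (Fin n))).filter (fun W => Disjoint W A),
          (prodBernoulli u).real
              {ω : BondConfig (Fin n) | ∀ z : Fin n, (z ∈ W ↔ ω ∈ ⋃ v ∈ insert x T, openConn v z)}
            * A.inf' ⟨b, hb⟩ (fun a => (prodBernoulli u).real (openConnIn ((W : Set (Fin n))ᶜ) a b)))
        = ∑ B : Finset (Fin n),
            (prodBernoulli u).real
                {ω : BondConfig (Fin n) | ∀ y : Fin n, y ∈ B ↔ (y ∉ ({x} : Finset (Fin n)) ∧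
                  ∃ o ∈ ({x} : Finset (Fin n)), s(o, y) ∈ ω)}
              * (∑ W ∈ (Finset.univ : Finset (Finset (Fin n))).filter (fun W => Disjoint W A),
                  (prodBernoulli (fun e : Sym2 (Fin n) =>
                      if (∀ y ∈ e, y ∈ B) ∧ ¬ e.IsDiag then 1 else
                        if (∃ y ∈ e, y ∈ ({x} : Finset (Fin n))) then 0 else u e)).real
                      {ω : BondConfig (Fin n) | ∀ z : Fin n, (z ∈ W ↔ ω ∈ ⋃ v ∈ T ∪ B, openConn v z)}
                    * A.inf' ⟨b, hb⟩ (fun a => (prodBernoulli (fun e : Sym2 (Fin n) =>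
                        if (∀ y ∈ e, y ∈ B) ∧ ¬ e.IsDiag then 1 else
                          if (∃ y ∈ e, y ∈ ({x} : Finset (Fin n))) then 0 else u e)).real
                        (openConnIn ((W : Set (Fin n))ᶜ) a b))) := by
  intro n u A T x b hb hxT hxA
  refine bystP_engine u
    (fun (B : Finset (Fin n)) (e : Sym2 (Fin n)) =>
      if (∀ y ∈ e, y ∈ B) ∧ ¬ e.IsDiag then 1 else if (∃ y ∈ e, y ∈ ({x} : Finset (Fin n))) then 0 else u e)
    (fun B : Finset (Fin n) => {ω : BondConfig (Fin n) | ∀ y : Fin n, y ∈ B ↔ (y ∉ ({x} : Finset (Fin n)) ∧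
      ∃ o ∈ ({x} : Finset (Fin n)), s(o, y) ∈ ω)})
    (fun (B : Finset (Fin n)) (ω : BondConfig (Fin n)) =>
      ({e | e ∈ ω ∧ ∀ y ∈ e, y ∉ ({x} : Finset (Fin n))} ∪ {e | (∀ y ∈ e, y ∈ B) ∧ ¬ e.IsDiag} :
        BondConfig (Fin n)))
    A T x b hb hxT hxA ?_ ?_ ?_ ?_ ?_ ?_
  · exact fun F => sigmaRec_partition u {x} F
  · intro B E
    have h := stub_sigmaLaw n u {x} B E
    rw [goodStep24_glue_singleton u x] at h
    exact h
  · intro B W ω hL hxW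
    exact bystP_geometry T B W x hxT hxW ω hL
  · intro B hB hxB
    apply hB
    rw [Set.eq_empty_of_forall_notMem (s := {ω : BondConfig (Fin n) | ∀ y : Fin n, y ∈ B ↔
        (y ∉ ({x} : Finset (Fin n)) ∧ ∃ o ∈ ({x} : Finset (Fin n)), s(o, y) ∈ ω)})
        fun ω hω => ((hω x).1 hxB).1 (Finset.mem_singleton_self x), measureReal_empty]
  · intro B hxB z
    rw [if_neg, if_pos]
    · exact ⟨x, Sym2.mem_mk_left x z, Finset.mem_singleton_self x⟩
    · rintro ⟨h, -⟩
      exact hxB (h x (Sym2.mem_mk_left x z))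
  · intro B W hxW hBW e he
    obtain ⟨y, hy⟩ : ∃ y, y ∈ e := ⟨e.out.1, Sym2.out_fst_mem e⟩
    have hmem : ∀ v ∈ e, v ∉ W := fun v hv hvW => Set.mem_sym2_iff_subset.1 he hv (Finset.mem_coe.2 hvW)
    rw [if_neg, if_neg]
    · rintro ⟨v, hv, hvx⟩
      exact hmem v hv ((Finset.mem_singleton.1 hvx) ▸ hxW)
    · rintro ⟨h, -⟩
      exact hmem y hy (hBW (h y hy))

end

end Summit.CriticalPhenomena.PercolationContinuityZ3.Theorems
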